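import Literature.NumberTheory.EllipticCurves.ReductionInertiaInvarianceProofs
import HarnessLib

/-!
# An isometric automorphism fixing the equation acts on `E⁰(L)` and through the residue field
on the reduction (Silverman *AEC* VII.§2, VIII.§1; Neukirch *ANT* II §9)

Companion of `ReductionInertiaInvarianceProofs` §Transport (there: an element of the *inertia*
group acts trivially on reductions) and of `NodeReductionGaloisProofs` (the node case, with the
reduction map onto the torus), for an arbitrary `w`-isometry `σ` (an element of a *decomposition*
group), in the same presentation: `W₀` a Weierstrass equation over the valuation ring `𝒪_w` of a
valued field `(L, w)`, `X` an equation over a subfield `F₀ ⊆ L` with `X_L = (W₀)_L`, `σ` an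
`F₀`-algebra endomorphism of `L` with `w ∘ σ = w`; points of `X(L)` are moved to `W₀` by the
identity on coordinates (`Affine.Point.congrEquiv`).

* `exists_residueMap_of_isometry` — `σ` induces a ring endomorphism `σ̄` of the residue field
  `k` of `𝒪_w` with `σ̄ ā = \overline{σ a}` (Neukirch *ANT* II (9.4): the decomposition group maps
  to `Aut(k)`);
* `map_residueMap_reduction_eq` — `σ̄` fixes the reduced equation `W̃₀ = W₀ mod 𝔪_w` (its
  coefficients come from `F₀`);
* `hasNonsingularReduction_congrEquiv_map_of_isometry` — **`E⁰(L)` is `σ`-stable**: if `P` has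
  non-singular reduction then so has `P^σ` (the reduction of `P^σ` is `σ̄` applied to that of `P`,
  a non-singular point of `σ̄ W̃₀ = W̃₀`).

These are the hypotheses `hsE` (and the residue map behind `t`) of
`KramerTunnell1982.exists_add_eq_of_hasNonsingularReduction` (`NonsingularReductionNormProofs`)
for `s = σ`, on the way to Kramer–Tunnell's "`N : E⁰(K) → E⁰(F)` is surjective" (Compositio
Math. 46 (1982), §6 p. 327) at places of bad reduction.  Theorems only; no definition, no named
fact, no `sorry` (D-0026: net debt `0`).

## References

* [SilvermanAEC2009] J. H. Silverman, *The Arithmetic of Elliptic Curves*, 2nd ed., VII.§2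
  (`E₀`, `E₁`, reduction), VIII.§1 (Galois action and reduction).
* [NeukirchANT1999] J. Neukirch, *Algebraic Number Theory*, Ch. II §9, (9.4) (the homomorphism
  `G_w → Aut(κ)` of a decomposition group).
* [KramerTunnell1982] K. Kramer, J. Tunnell, Compositio Math. 46 (1982), §6 p. 327.
-/

noncomputable section

open scoped Classical NNReal

universe u

namespace Literature.NumberTheory.EllipticCurves.KramerTunnell1982

open Literature.NumberTheory.EllipticCurves
open _root_.WeierstrassCurve

variable {L : Type u} [Field L] {w : Valuation L ℝ≥0}

/-! ## §1 The residue endomorphism of an isometry -/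

section ResidueMap

/-- **The residue endomorphism of an isometry** (Neukirch, *ANT* II (9.4): `σ ↦ σ̄`,
`G_w → Aut κ`): a ring endomorphism `σ` of `L` with `w ∘ σ = w` maps `𝒪_w` to itself by a local
homomorphism, hence induces `σ̄ : k → k` on the residue field with `σ̄ ā = \overline{σ a}`.
Produced existentially (Mathlib `IsLocalRing.ResidueField.map`); no definition.
[cite: NeukirchANT1999, Ch. II §9 (9.4)] -/
theorem exists_residueMap_of_isometry (σ : L →+* L) (hσ₁ : ∀ z, w (σ z) = w z) :
    ∃ σk : IsLocalRing.ResidueField w.integer →+* IsLocalRing.ResidueField w.integer,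
      ∀ (a : L) (ha : w a ≤ 1) (hσa : w (σ a) ≤ 1),
        σk (IsLocalRing.residue w.integer ⟨a, ha⟩) = IsLocalRing.residue w.integer ⟨σ a, hσa⟩ := by
  have hv : w.Integers w.integer := Valuation.integer.integers w
  have hmem : ∀ a : w.integer, σ (a : L) ∈ w.integer := fun a => by
    change w (σ a) ≤ 1; rw [hσ₁]; exact a.2
  let σO : w.integer →+* w.integer := (σ.comp w.integer.subtype).codRestrict w.integer hmem
  have hσO : ∀ a : w.integer, ((σO a : w.integer) : L) = σ a := fun a => rfl
  haveI : IsLocalHom σO := by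
    refine ⟨fun a ha => ?_⟩
    rw [hv.isUnit_iff_valuation_eq_one] at ha ⊢
    change w ((σO a : w.integer) : L) = 1 at ha
    rwa [hσO, hσ₁] at ha
  refine ⟨IsLocalRing.ResidueField.map σO, fun a ha hσa => ?_⟩
  rw [IsLocalRing.ResidueField.map_residue]
  exact congrArg _ (Subtype.ext rfl)

end ResidueMap

/-! ## §2 `E⁰(L)` is stable under an isometry fixing the equation -/

section Transport

variable (W₀ : WeierstrassCurve w.integer) {F₀ : Type*} [Field F₀] [Algebra F₀ L]
  {X : WeierstrassCurve F₀} (hX : X.baseChange L = W₀.baseChange L) (σ : L →ₐ[F₀] L)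
  (hσ₁ : ∀ z, w (σ z) = w z)

include hX in
/-- The coefficients of `W₀` are those of `X` (in `F₀`), so `σ` fixes them. [folklore] -/
private theorem algEquiv_coe_a_eq :
    σ (W₀.a₁ : L) = W₀.a₁ ∧ σ (W₀.a₂ : L) = W₀.a₂ ∧ σ (W₀.a₃ : L) = W₀.a₃ ∧
      σ (W₀.a₄ : L) = W₀.a₄ ∧ σ (W₀.a₆ : L) = W₀.a₆ := by
  have h₁ := congrArg WeierstrassCurve.a₁ hX
  have h₂ := congrArg WeierstrassCurve.a₂ hX
  have h₃ := congrArg WeierstrassCurve.a₃ hX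
  have h₄ := congrArg WeierstrassCurve.a₄ hX
  have h₆ := congrArg WeierstrassCurve.a₆ hX
  rw [baseChange_a₁, baseChange_a₁] at h₁
  rw [baseChange_a₂, baseChange_a₂] at h₂
  rw [baseChange_a₃, baseChange_a₃] at h₃
  rw [baseChange_a₄, baseChange_a₄] at h₄
  rw [baseChange_a₆, baseChange_a₆] at h₆
  refine ⟨?_, ?_, ?_, ?_, ?_⟩
  · change σ (algebraMap w.integer L W₀.a₁) = algebraMap w.integer L W₀.a₁
    rw [← h₁, AlgHom.commutes]
  · change σ (algebraMap w.integer L W₀.a₂) = algebraMap w.integer L W₀.a₂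
    rw [← h₂, AlgHom.commutes]
  · change σ (algebraMap w.integer L W₀.a₃) = algebraMap w.integer L W₀.a₃
    rw [← h₃, AlgHom.commutes]
  · change σ (algebraMap w.integer L W₀.a₄) = algebraMap w.integer L W₀.a₄
    rw [← h₄, AlgHom.commutes]
  · change σ (algebraMap w.integer L W₀.a₆) = algebraMap w.integer L W₀.a₆
    rw [← h₆, AlgHom.commutes]

include hX in
/-- **`σ̄` fixes the reduced equation**: for the residue endomorphism `σ̄` of an `F₀`-isometry
`σ` (`exists_residueMap_of_isometry`), `σ̄ W̃₀ = W̃₀`, since the coefficients of `W₀` are those of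
`X`, in `F₀`. [cite: SilvermanAEC2009, VIII.§1 (reduction and the Galois action)] -/
theorem map_residueMap_reduction_eq
    {σk : IsLocalRing.ResidueField w.integer →+* IsLocalRing.ResidueField w.integer}
    (hσk : ∀ (a : L) (ha : w a ≤ 1) (hσa : w (σ a) ≤ 1),
      σk (IsLocalRing.residue w.integer ⟨a, ha⟩) = IsLocalRing.residue w.integer ⟨σ a, hσa⟩) :
    (W₀.map (IsLocalRing.residue w.integer)).map σk = W₀.map (IsLocalRing.residue w.integer) := by
  have key : ∀ a : w.integer, σ (a : L) = a →
      σk (IsLocalRing.residue w.integer a) = IsLocalRing.residue w.integer a := by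
    intro a ha
    have hσa : w (σ (a : L)) ≤ 1 := by rw [ha]; exact a.2
    have h := hσk (a : L) a.2 hσa
    simp only [Subtype.coe_eta] at h
    rw [h]
    exact congrArg _ (Subtype.ext ha)
  obtain ⟨h₁, h₂, h₃, h₄, h₆⟩ := algEquiv_coe_a_eq W₀ hX σ
  ext <;> simp only [WeierstrassCurve.map_a₁, WeierstrassCurve.map_a₂, WeierstrassCurve.map_a₃,
    WeierstrassCurve.map_a₄, WeierstrassCurve.map_a₆, key _ h₁, key _ h₂, key _ h₃, key _ h₄,
    key _ h₆]

include hX hσ₁ in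
/-- **`E⁰(L)` is stable under an `F₀`-isometry**: if `P ∈ X(L)` has non-singular reduction on
`W₀` then so has `P^σ`.  Either `x(P) ∉ 𝒪_w` (then also `x(P^σ) = σ x(P) ∉ 𝒪_w`: both reduce
to `Õ`), or `P` is integral with reduction `(x̄, ȳ)` non-singular on `W̃₀`, and `P^σ` is integral
with reduction `(σ̄ x̄, σ̄ ȳ)`, non-singular on `σ̄ W̃₀ = W̃₀` (`map_residueMap_reduction_eq`,
Mathlib `Affine.map_nonsingular`).  Silverman, *AEC*, VIII.§1 (the decomposition group acts on
`Ẽ`, preserving `Ẽ_ns`). [cite: SilvermanAEC2009, VIII.§1 and VII.§2 (reduction and the Galois action)] -/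
theorem hasNonsingularReduction_congrEquiv_map_of_isometry (P : (X.baseChange L).toAffine.Point)
    (hP : W₀.HasNonsingularReduction (Affine.Point.congrEquiv hX P)) :
    W₀.HasNonsingularReduction (Affine.Point.congrEquiv hX (Affine.Point.map σ P)) := by
  have hv : w.Integers w.integer := Valuation.integer.integers w
  obtain ⟨σk, hσk0⟩ := exists_residueMap_of_isometry (w := w) (σ : L →+* L) hσ₁
  have hσk : ∀ (a : L) (ha : w a ≤ 1) (hσa : w (σ a) ≤ 1),
      σk (IsLocalRing.residue w.integer ⟨a, ha⟩) = IsLocalRing.residue w.integer ⟨σ a, hσa⟩ :=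
    fun a ha hσa => hσk0 a ha hσa
  have hfix := map_residueMap_reduction_eq W₀ hX σ hσk
  rcases P with _ | ⟨x, y, h⟩
  · rw [← Affine.Point.zero_def, map_zero, map_zero]
    exact WeierstrassCurve.hasNonsingularReduction_zero
  · rw [Affine.Point.map_some, Affine.Point.congrEquiv_some]
    rw [Affine.Point.congrEquiv_some] at hP
    by_cases hx : w x ≤ 1
    · have hy : w y ≤ 1 := v_Y_le_one_of_v_X_le_one hv (hX ▸ h).1 hx
      have hx' : w (σ x) ≤ 1 := by rw [hσ₁]; exact hx
      have hy' : w (σ y) ≤ 1 := by rw [hσ₁]; exact hy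
      have hh : (W₀.baseChange L).toAffine.Nonsingular (algebraMap w.integer L ⟨x, hx⟩)
          (algebraMap w.integer L ⟨y, hy⟩) := hX ▸ h
      have hh' : (W₀.baseChange L).toAffine.Nonsingular (algebraMap w.integer L ⟨σ x, hx'⟩)
          (algebraMap w.integer L ⟨σ y, hy'⟩) :=
        hX ▸ (X.toAffine.baseChange_nonsingular (σ : L →ₐ[F₀] L).injective x y).mpr h
      change W₀.HasNonsingularReduction (.some _ _ hh) at hP
      change W₀.HasNonsingularReduction (.some _ _ hh')
      rw [WeierstrassCurve.hasNonsingularReduction_some_algebraMap_iff hv.hom_inj hh] at hP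
      rw [WeierstrassCurve.hasNonsingularReduction_some_algebraMap_iff hv.hom_inj hh',
        ← hσk x hx hx', ← hσk y hy hy', ← hfix]
      exact (WeierstrassCurve.Affine.map_nonsingular _ σk.injective _ _).mpr hP
    · have hx1 : 1 < w (σ x) := by rw [hσ₁]; exact not_le.mp hx
      exact Or.inl ((not_mem_range_iff hv).mpr hx1)

end Transport

end Literature.NumberTheory.EllipticCurves.KramerTunnell1982

end
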